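import Mathlib
import Literature.Analysis.FluidPDE.VectorCalculus

/-!
Sketch for crux-ideate stmt-AnomalousDissipation-18627 (HalfSpaceHierarchy), ideator 3, round 1.
First lemmas of the two idea cards, stated over existing declarations
(`Literature.Analysis.FluidPDE.curl`, `Literature.Analysis.FluidPDE.cross`, Mathlib `fderiv`,
`gradient`). They need not be proved here; they must elaborate.
-/

noncomputable section

open Literature.Analysis.FluidPDE

namespace Summit.AnomalousDissipation.AnomalousDissipation.Cruxes.HalfSpaceHierarchy.Sketch

local notation "E³" => EuclideanSpace ℝ (Fin 3)

/-- Card `flat-bernoulli-leaves`, first lemma (Arnold's commuting frame): for a `C²` steady Euler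
pair `(V, Q)` on an open set `U` (divergence free, `(V·∇)V + ∇Q = 0`), velocity and vorticity
commute as vector fields: `(V·∇)ω − (ω·∇)V = 0` on `U`, `ω = curl V`. Equivalently the steady
vorticity equation; it is what makes every regular Bernoulli level a translation surface with
global frame `(V, ω)`. -/
def SteadyEulerCommutesWithCurl : Prop :=
  ∀ (V : E³ → E³) (Q : E³ → ℝ) (U : Set E³), IsOpen U →
    ContDiffOn ℝ 2 V U → ContDiffOn ℝ 2 Q U →
    (∀ X ∈ U, ∑ i : Fin 3, (fderiv ℝ V X (EuclideanSpace.single i (1 : ℝ))) i = 0) →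
    (∀ X ∈ U, (fderiv ℝ V X) (V X) + gradient Q X = 0) →
    ∀ X ∈ U, fderiv ℝ (curl V) X (V X) - fderiv ℝ V X (curl V X) = 0

/-- Card `flat-bernoulli-leaves`, companion identity (unimodularity of the frame): with
`B = ‖V‖²/2 + Q` the Bernoulli function, steady Euler gives `V × ω = ∇B`; hence on a regular
level of `B` the triple `(V, ω, N)` with `dB(N) = 1` spans unit volume:
`⟪cross (V X) (curl V X), N⟫ = 1` whenever `⟪gradient B X, N⟫ = 1`. Stated as the Lamb-vector
identity it rests on. -/
def LambVectorIsBernoulliGradient : Prop :=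
  ∀ (V : E³ → E³) (Q : E³ → ℝ) (U : Set E³), IsOpen U →
    ContDiffOn ℝ 1 V U → ContDiffOn ℝ 1 Q U →
    (∀ X ∈ U, (fderiv ℝ V X) (V X) + gradient Q X = 0) →
    ∀ X ∈ U, cross (V X) (curl V X) = gradient (fun Y => ‖V Y‖ ^ 2 / 2 + Q Y) X

/-- Card `octave-transfer-rpf`, first lemma (dilution of vorticity per octave): a field of
degree `0` under `X ↦ 2X` on the open half-space has vorticity of degree `−1`:
`curl V (2X) = ½ curl V (X)`. Together with the flux scaling below this is the balance the
octave transfer operator must restore by stretching (leading eigenvalue `1`). -/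
def CurlOfDegreeZeroField : Prop :=
  ∀ (V : E³ → E³), (∀ X : E³, 0 < X 2 → DifferentiableAt ℝ V X) →
    (∀ X : E³, 0 < X 2 → V ((2 : ℝ) • X) = V X) →
    ∀ X : E³, 0 < X 2 → curl V ((2 : ℝ) • X) = (1 / 2 : ℝ) • curl V X

/-- Card `octave-transfer-rpf`, first lemma (flux quadrupling per octave): for a continuous
degree-`0` field the vertical mass flux through the dilated square at the dilated height is four
times the flux through the original square — the descending-streamline return map, conjugated by
the dilation, multiplies the flux measure by `4` (it is `4 : 1` on the torus quotient). -/
def FluxQuadruplesPerOctave : Prop :=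
  ∀ (V : E³ → E³), Continuous V →
    (∀ X : E³, 0 < X 2 → V ((2 : ℝ) • X) = V X) →
    ∀ (a c : ℝ), 0 < a → 0 < c →
      (∫ q in Set.Icc (0 : ℝ) (2 * a) ×ˢ Set.Icc (0 : ℝ) (2 * a), (V !₂[q.1, q.2, 2 * c]) 2)
        = 4 * ∫ q in Set.Icc (0 : ℝ) a ×ˢ Set.Icc (0 : ℝ) a, (V !₂[q.1, q.2, c]) 2

/-- Card `octave-transfer-rpf`, the Clebsch/Grad–Rubin variational identity it leans on
(classical): if `V = ∇α × ∇β` and `ω = curl V` satisfies `⟪ω, ∇α⟫ = 0`, `⟪ω, ∇β⟫ = −G'(α)`, then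
`(V, Q)` with `Q = G ∘ α − ‖V‖²/2` is a steady Euler pair with Bernoulli function `G ∘ α`. -/
def ClebschCriticalPointIsSteadyEuler : Prop :=
  ∀ (α β : E³ → ℝ) (G : ℝ → ℝ) (U : Set E³), IsOpen U →
    ContDiffOn ℝ 3 α U → ContDiffOn ℝ 3 β U → ContDiff ℝ 2 G →
    let V : E³ → E³ := fun X => cross (gradient α X) (gradient β X)
    (∀ X ∈ U, inner ℝ (curl V X) (gradient α X) = 0) →
    (∀ X ∈ U, inner ℝ (curl V X) (gradient β X) = - deriv G (α X)) →
    ∀ X ∈ U, (fderiv ℝ V X) (V X) + gradient (fun Y => G (α Y) - ‖V Y‖ ^ 2 / 2) X = 0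

/-- Card `octave-transfer-rpf`, abstract dichotomy lemma (super-critical half): in a real Banach space, if
`K` is an isometric embedding (the Koopman operator of the 4 : 1 return map) and `A` is invertible with
`w * ‖A⁻¹‖ < 1` (the octave cocycle amplifies more than the scaling weight `w`), then the matching operator
`A − w • K` is invertible (forward Neumann series). Pure functional analysis over Mathlib. -/
def SuperCriticalMatchingInvertible : Prop :=
  ∀ (X : Type) [NormedAddCommGroup X] [NormedSpace ℝ X] [CompleteSpace X]
    (K : X →L[ℝ] X) (A : X ≃L[ℝ] X) (w : ℝ), 0 ≤ w →
    (∀ x : X, ‖K x‖ = ‖x‖) →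
    w * ‖(A.symm : X →L[ℝ] X)‖ < 1 →
    IsUnit ((A : X →L[ℝ] X) - w • K)

/-- Card `octave-transfer-rpf`, abstract dichotomy lemma (sub-critical half): if instead `‖A‖ < w`, then
`A − w • K` is bounded below (injective with closed range) but NOT surjective as soon as `K` is not surjective —
the range misses as much as the range of `K` does (semi-Fredholm stability). Stated in the weak form
"not surjective". -/
def SubCriticalMatchingNotSurjective : Prop :=
  ∀ (X : Type) [NormedAddCommGroup X] [NormedSpace ℝ X] [CompleteSpace X]
    (K : X →L[ℝ] X) (A : X →L[ℝ] X) (w : ℝ), 0 < w →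
    (∀ x : X, ‖K x‖ = ‖x‖) → ¬ Function.Surjective K →
    ‖A‖ < w →
    ¬ Function.Surjective ((A - w • K : X →L[ℝ] X) : X → X)

end Summit.AnomalousDissipation.AnomalousDissipation.Cruxes.HalfSpaceHierarchy.Sketch

end
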